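import Mathlib
import Summits.NavierStokesRegularity.NavierStokesRegularity.Theorems.TaoLadderRungTwoBreakOneShiftWindowGridUpto
import Summits.NavierStokesRegularity.NavierStokesRegularity.Theorems.TaoLadderRungTwoBreakOneShiftWindowKrawczykRowsD
import Summits.NavierStokesRegularity.NavierStokesRegularity.Theorems.TaoLadderRungTwoBreakOneShiftWindowRangeCertD
import HarnessLib

/-!
# The one-shift window system, XLVIa: THE LINK DATA between a grid (parts XXXIX/XLV) and a Krawczyk datum (part XLII)
# and the instance's FRAME-MATCHING facts — the vocabulary of the frame-level glue to (K1) (part XLVI, sequel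
# …OneShiftWindowK1Glue) (cell harvest/h2-tao-ladder, seat p2; rung1/KERNEL-CHEAP-REPLAY-SPEC.md §9 (G)/(I); support
# for K1(1) = `NoSurvivingDSSOne`, stmt-NavierStokesRegularity-20205)

MODEL lattice ODEs only (Tao 2016 §4 normal form on Tao's shift set `S`); nothing here is a statement about
the Navier–Stokes equations; no item is closed; no instance is evaluated here.

* `tjet_one` (the order-1 flow Taylor map is the field);
* `GridD.finFv` (the order-1 interval jet of the rough field of the final step over its hull), `GridD.linkK1` — the
  LINK BOOLEAN between a grid and a Krawczyk datum (`Zb ⊇ Hs_S`, `Ub ⊇ V_{S+1}`, `Fv ⊇ finFv`, energy box positive,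
  `gCert`, `gamCert`, `KrawD.check`), `GridD.of_linkK1`;
* `ResSlopeD.mem_energyBox_of` (the shell-1 energy of a run in the hull);
* `OneShiftFrame.linOfMatrix` (the linear preconditioner of a real matrix, `coord_linOfMatrix` = `hC` of part X);
  `isRunFrom_windowRunMap`, `abs_flatRun_zero_sub_yc_le`, `preclampTau_mem_box`;
* `OneShiftFrame.FrameMatch` — the instance's frame-matching facts (combinatorics of the numbering, box radii,
  `r_τ`, tail Lipschitz bound, top tube, first start box ⊇ Krawczyk box, the flight box inside the final step).
-/

noncomputable section

-- the sub-problem namespace repeats the summit name by design (D-0017)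
set_option linter.dupNamespace false

namespace Summit.NavierStokesRegularity.NavierStokesRegularity.Theorems

namespace DSSOneShift

open Set Finset Metric Filter Topology TopologicalSpace
open Literature.Analysis.ODE Literature.Analysis.FluidPDE Literature.Analysis.FluidPDE.TaoCascade
open Summit.NavierStokesRegularity.NavierStokesRegularity.Theorems.TaylorModelCert
open Summit.NavierStokesRegularity.NavierStokesRegularity.Theorems.TaylorModelReadout
open Summit.NavierStokesRegularity.NavierStokesRegularity.Theorems.CertificateGlueOn

/-! ### The order-1 flow Taylor map is the field -/

/-- `Φ_1 = f` for a term-list field. [cite: Moore1979, §3.4 eq. (3.14); HairerWannerLubich2002, §III.5.1 eq. (5.8)] -/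
theorem tjet_one {ι : Type*} [Fintype ι] [DecidableEq ι] {κ : Type*} [Fintype κ] (T : κ → BTerm ι) (x : ι → ℝ) :
    tjet T 1 x = termField T x :=
  smoothTaylorMap_one (termField_contDiffOn T) (x := x) trivial

/-! ### The data side of the link: the field jet of the final step and the link Boolean -/

namespace GridD

variable (g : GridD)

/-- The order-1 interval jet of the ROUGH field of the final step over its hull `Hs_S` (slot `q` = physical
coordinate `q`): the field-value hull the flight-time column of the run slope needs. [cite: Moore1979, §3.4 eq. (3.14) and §3.2; cell vocabulary, harvest/h2-tao-ladder rung1/KERNEL-CHEAP-REPLAY-SPEC.md §9 (G) (f-hull)] -/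
def finFv : Array IntervalD :=
  IntervalD.lget (IntervalD.jetLevelsA ((g.step g.S).n + 1)
    (sqEvalA ((g.step g.S).n + 1) (g.step g.S).prec (sqR (g.step g.S).n (g.step g.S).prec (g.step g.S).RD))
    (g.step g.S).prec ((g.step g.S).toRoughStepD.centre.ext (g.step g.S).Hs) 1) 1

/-- **THE LINK BOOLEAN** between a grid and a Krawczyk datum: equal dimensions; the hull box `Zb` of the residual-slope
data contains the final hull `Hs_S`; its flow-slope box `Ub` contains `V_{S+1}`; its field box `Fv` contains `finFv`;
the shell-1 energy box is positive; the square / cube certificates of `G`, `Γ` over the energy box; the Krawczyk-rows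
test. [cite: Tao2016AveragedNS, §5.3; cell vocabulary, harvest/h2-tao-ladder rung1/KERNEL-CHEAP-REPLAY-SPEC.md §9 (G)] -/
def linkK1 (kd : KrawD) : Bool :=
  decide (kd.rs.n = g.n) &&
  ((List.range g.n).all fun q => IntervalD.subset (IntervalD.aget (g.step g.S).Hs q) (IntervalD.aget kd.rs.Zb q)) &&
  ((List.range g.n).all fun p => (List.range g.n).all fun q =>
    IntervalD.subset (g.Vent (g.S + 1) p q) (IntervalD.aget kd.rs.Ub (q * g.n + p))) &&
  ((List.range g.n).all fun q => IntervalD.subset (IntervalD.aget g.finFv q) (IntervalD.aget kd.rs.Fv q)) &&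
  Dyad.blt (Dyad.ofInt 0) kd.rs.energyBox.lo &&
  gCert kd.rs.energyBox.lo kd.rs.energyBox.hi kd.rs.G &&
  gamCert kd.rs.energyBox.lo kd.rs.energyBox.hi kd.rs.Gam &&
  kd.check

/-- Unpacking the link Boolean. [folklore] -/
theorem of_linkK1 {kd : KrawD} (h : g.linkK1 kd = true) :
    kd.rs.n = g.n ∧
    (∀ q < g.n, IntervalD.subset (IntervalD.aget (g.step g.S).Hs q) (IntervalD.aget kd.rs.Zb q) = true) ∧
    (∀ p < g.n, ∀ q < g.n, IntervalD.subset (g.Vent (g.S + 1) p q) (IntervalD.aget kd.rs.Ub (q * g.n + p)) = true) ∧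
    (∀ q < g.n, IntervalD.subset (IntervalD.aget g.finFv q) (IntervalD.aget kd.rs.Fv q) = true) ∧
    0 < kd.rs.energyBox.lo.toReal ∧
    gCert kd.rs.energyBox.lo kd.rs.energyBox.hi kd.rs.G = true ∧
    gamCert kd.rs.energyBox.lo kd.rs.energyBox.hi kd.rs.Gam = true ∧ kd.check = true := by
  unfold linkK1 at h
  simp only [Bool.and_eq_true, List.all_eq_true, List.mem_range, decide_eq_true_eq] at h
  obtain ⟨⟨⟨⟨⟨⟨⟨h1, h2⟩, h3⟩, h4⟩, h5⟩, h6⟩, h7⟩, h8⟩ := h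
  exact ⟨h1, h2, h3, h4, by simpa using (Dyad.blt_iff _ _).1 h5, h6, h7, h8⟩

end GridD

/-! ### The shell-1 energy of a run in the hull -/

namespace ResSlopeD

/-- The shell-1 energy of any `z` whose shell-1 entries lie in `Zb` lies in `energyBox` (part XLIII `mem_energyBox`
from the three fields it uses). [folklore] -/
theorem mem_energyBox_of {d : ResSlopeD} {m : ℕ} {F : OneShiftFrame m} (e : Fin m × Fin F.W ≃ Fin d.n)
    (hW1 : 1 < F.W) (hm : d.nm = m) (hidx1 : ∀ i : Fin m, natget d.idx1 i = (e (i, ⟨1, hW1⟩) : ℕ))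
    {z : Fin m → ℤ → ℝ} (hz : ∀ i : Fin m, IntervalD.mem (z i 1) (IntervalD.aget d.Zb (e (i, ⟨1, hW1⟩)))) :
    IntervalD.mem (∑ i, z i 1 ^ 2) d.energyBox := by
  unfold energyBox
  rw [hm]
  refine mem_sum_equiv (Equiv.refl (Fin m)) d.prec fun k hk => ?_
  simp only [Equiv.refl_symm, Equiv.refl_apply]
  rw [hidx1 ⟨k, hk⟩]
  exact IntervalD.mem_sqrR d.prec (hz ⟨k, hk⟩)

end ResSlopeD

variable {m : ℕ}

namespace OneShiftFrame

variable (F : OneShiftFrame m)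

/-! ### The linear preconditioner of a real matrix -/

/-- The linear map of the window block with coordinate matrix `Cmat`. [folklore] -/
def linOfMatrix (Cmat : F.WIdx → F.WIdx → ℝ) : F.WState × ℝ → F.WState × ℝ := fun x =>
  (fun i j => ∑ r', Cmat (some (i, j)) r' * F.coord x r', ∑ r', Cmat none r' * F.coord x r')

/-- Its coordinates (hypothesis `hC` of part X). [folklore] -/
theorem coord_linOfMatrix (Cmat : F.WIdx → F.WIdx → ℝ) (x : F.WState × ℝ) (r : F.WIdx) :
    F.coord (F.linOfMatrix Cmat x) r = ∑ r', Cmat r r' * F.coord x r' := by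
  rcases r with _ | ⟨i, j⟩ <;> rfl

/-! ### Runs of admissible points -/

/-- **The window-run map of an admissible point is a run from its pre-clamped data** (parts IV/VI).
[cite: Tao2016AveragedNS, §4 Lemma 4.1 (4.8); Teschl2012, Cor. 2.16; cell vocabulary, harvest/h2-tao-ladder rung1/KERNEL-STAGE3-PLAN.md §2] -/
theorem isRunFrom_windowRunMap {ε₀ : ℝ} (hε : 0 ≤ ε₀) (hW : 0 < F.W)
    {α : Fin m → Fin m → Fin m → ℤ × ℤ × ℤ → ℝ} (hα : IsCancellingCoeff α)
    (hEb : ∀ i, |F.tubeC i (-1)| + F.tubeR (-1) ≤ F.Eb) (hEt : ∀ i, |F.tubeC i F.W| + F.tubeR F.W ≤ F.Et)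
    {u : F.Space} (hu : F.Adm u) :
    F.IsRunFrom ε₀ α (F.preclampY u) (F.preclampTail u) (F.windowRunMap ε₀ α (F.preclampY u) (F.preclampTail u)) := by
  have hAdm : F.AdmData (F.preclampY u) (F.preclampTail u) := by
    rw [F.preclampY_eq_decodeY hu, F.preclampTail_eq_decodeTail_fun hu]; exact F.admData_decode hu
  have h := F.windowRunMap_spec hε hW hα hEb hEt hAdm
  exact ⟨h.2, h.1, fun i k hk => F.windowRunMap_tail ε₀ α _ _ i hk⟩

/-- The flat start of a run from the pre-clamped data of a point lies in the Krawczyk box. [folklore] -/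
theorem abs_flatRun_zero_sub_yc_le {ε₀ : ℝ} {α : Fin m → Fin m → Fin m → ℤ × ℤ × ℤ → ℝ} {u : F.Space}
    {T S : Fin m → ℤ → ℝ → ℝ} (hS : F.IsRunFrom ε₀ α (F.preclampY u) T S) (c : F.SIdx) :
    |F.flatRun S 0 c - F.yc c.1 ((c.2 : ℕ) : ℤ)| ≤ F.a c.1 ((c.2 : ℕ) : ℤ) := by
  rw [F.flatRun_zero hS c, F.preclampY_natCast]
  have ha := F.a_pos c.1 ((c.2 : ℕ) : ℤ)
  have hc := abs_clampUnit_le (u.1 c.1 c.2)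
  rw [show F.yc c.1 ((c.2 : ℕ) : ℤ) + F.a c.1 ((c.2 : ℕ) : ℤ) * clampUnit (u.1 c.1 c.2) - F.yc c.1 ((c.2 : ℕ) : ℤ) =
      F.a c.1 ((c.2 : ℕ) : ℤ) * clampUnit (u.1 c.1 c.2) by ring, abs_mul, abs_of_pos ha]
  nlinarith

/-- The pre-clamped flight time lies in the flight box `[τc − rτ, τc + rτ]`. [folklore] -/
theorem preclampTau_mem_box (u : F.Space) : F.preclampTau u ∈ Icc (F.τc - F.rτ) (F.τc + F.rτ) := by
  have h := abs_le.1 (abs_clampUnit_le u.2.1)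
  have hr := F.rτ_pos
  simp only [preclampTau, Set.mem_Icc]
  constructor <;> nlinarith

/-! ### The instance's frame-matching facts -/

/-- **THE FRAME MATCHES THE DATA** (what the instance proves once, by `decide` / `norm_num`): equal dimensions of all
steps; the residual-slope data's combinatorics (`nm`, `succ`, `mode`, `idx1`, `idxD`) agree with the frame and the
numbering `e`; its boxes enclose the box radii `a`, the flight-time radius `r_τ`, the top tube, and its `RW` bounds
the top tail Lipschitz constant `R W`; the first start box contains the Krawczyk box; the flight box lies inside the
final grid step. [cite: Tao2016AveragedNS, §5.3; cell vocabulary, harvest/h2-tao-ladder rung1/KERNEL-CHEAP-REPLAY-SPEC.md §9 (G)/(I)] -/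
structure FrameMatch (g : GridD) (kd : KrawD) (e : F.SIdx ≃ Fin g.n) (R : ℤ → ℝ) : Prop where
  hW1 : 1 < F.W
  hDW : F.D < F.W
  hn : ∀ s, (g.step s).n = g.n
  hm : kd.rs.nm = m
  hsucc : ∀ i (j : Fin F.W), ResSlopeD.optget kd.rs.succ (e (i, j)) =
    if h : (j : ℕ) + 1 < F.W then some ((e (i, ⟨(j : ℕ) + 1, h⟩)) : ℕ) else none
  hmode : ∀ i (j : Fin F.W), ResSlopeD.natget kd.rs.mode (e (i, j)) = (i : ℕ)
  hidx1 : ∀ i : Fin m, ResSlopeD.natget kd.rs.idx1 i = (e (i, ⟨1, hW1⟩) : ℕ)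
  hidxD : ∀ i : Fin m, ResSlopeD.natget kd.rs.idxD i = (e (i, ⟨F.D, hDW⟩) : ℕ)
  ha : ∀ i (j : Fin F.W), IntervalD.mem (F.a i ((j : ℕ) : ℤ)) (IntervalD.aget kd.rs.aBox (e (i, j)))
  hrτ : IntervalD.mem F.rτ kd.rs.rtau
  hRW : R F.W ≤ kd.rs.RW.toReal
  hTtop : ∀ (i : Fin m) (x : ℝ), |x - F.tubeC i F.W| ≤ F.tubeR F.W → IntervalD.mem x (IntervalD.aget kd.rs.Ttop i)
  hW0 : ∀ x : F.SIdx → ℝ, (∀ c, |x c - F.yc c.1 ((c.2 : ℕ) : ℤ)| ≤ F.a c.1 ((c.2 : ℕ) : ℤ)) →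
    x ∈ boxSet (boxOf e (g.step 0).W)
  htS : g.t g.S ≤ F.τc - F.rτ
  hTS : F.τhi < g.t g.S + (g.h g.S).toReal

end OneShiftFrame

end DSSOneShift

end Summit.NavierStokesRegularity.NavierStokesRegularity.Theorems
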